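import Summits.BirchSwinnertonDyer.BirchSwinnertonDyer.Theorems.GenusKolyvaginAtTwoShaCardDvdPowAtTwoRTSharpExponentRat
import Literature.NumberTheory.EllipticCurves.BSDRankZeroDensityProofs
import Literature.NumberTheory.EllipticCurves.ComplexMultiplication
import HarnessLib

/-!
# Route `GenusKolyvaginAtTwo`, crux U_T `ShaCardDvdPowAtTwoRT` (stmt-BirchSwinnertonDyer-23658), LINE 19 `rational_pair_descent` —
# `E(ℚ) = 2E(ℚ)` and `rank E(ℚ) = 0` on the habitat (corollaries of the sharp exponent (B2Q))

Seat `bsd-line-gk2-p4` g22 (WIDTH-5 attach, cell `bsd-f1-sign2`), `--supports stmt-BirchSwinnertonDyer-23658 --as helper`.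
THEOREMS ONLY (no definition, no named fact, no `sorry`).  BSD is NOT proved by any of this; neither is U_T.

WHAT.  Sequel of `…RTSharpExponentRat` (p748779, `2^{M₀} • Sel_(2^M)(E/ℚ) = 0` on U_T's frame with `w(E) = +1`):
* `exists_eq_add_self_point_rat_onHabitat` — every point of `E(ℚ)` is twice a point of `E(ℚ)` (`δ_{2^{M₀+1}} P` is killed by `2^{M₀}`,
  so `2^{M₀} P = 2^{M₀+1} R`, and `E(ℚ)` has no `2`-power torsion); `exists_eq_add_self_point_baseChange_rat_onHabitat` — the same in the
  `(W.baseChange ℚ)` currency = EXACTLY the hypothesis `hodd` of the LEAD's inflation–restriction brick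
  `exists_resBaseChange_eq_of_conjH1Points_eq_of_rat_twoDivisible` (p748087; SANDWICH′ of LINE 19);
* `mordellWeilRank_rat_eq_zero_onHabitat` — **`rank_ℤ E(ℚ) = 0`** on the habitat (Kolyvagin's theorem over `ℚ` at `2` from the Heegner index
  and Q2; no L-value input) via `#(E(ℚ)/2E(ℚ)) = 2^{rank} · #E(ℚ)[2]` (tree `natCard_quotient_range_zsmul`);
* generic-field forms `exists_eq_add_self_of_kummer_two_pow_kill`, `mordellWeilRank_eq_zero_of_forall_exists_eq_add_self` (stated over any
  number field to keep clear of the `DecidableEq ℚ` instance diamond on `E(ℚ)`; the `ℚ` statements are `convert`ed).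

References: [Kolyvagin1989Izv] Thm. B₂; [GrossLMS1991] §1 Thm. 1.3; [SilvermanAEC2009] VIII.§2, Thm. VIII.6.7; [SerreGaloisCohomology1997] I §2.6.
-/

set_option autoImplicit false
-- the Theorems namespace of this sub repeats the summit name by design (D-0017 nested layout)
set_option linter.dupNamespace false

noncomputable section

open scoped Classical
open scoped AddSubgroup

namespace Summit.BirchSwinnertonDyer.BirchSwinnertonDyer.Theorems.GenusExact.PlusDescent

open WeierstrassCurve NumberField IsDedekindDomain Field Literature.NumberTheory.EllipticCurves
  Literature.NumberTheory.GaloisRepresentations Literature.NumberTheory.EllipticCurves.ModularForms AddSubgroup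
open Summit.BirchSwinnertonDyer.BirchSwinnertonDyer.Theses.GenusKolyvaginAtTwo (KolyvaginRelationAtTwo)
open Summit.BirchSwinnertonDyer.Rank1Residual

/-! ## `E(ℚ)` on the habitat: every rational point is twice a rational point; `rank E(ℚ) = 0` -/

section GenericField

variable {F : Type} [Field F] [NumberField F] (A : WeierstrassCurve F) [A.IsElliptic]

omit [A.IsElliptic] in
/-- Generic-field form (avoids the `DecidableEq ℚ` instance diamond on `E(ℚ)`): if `E(F)` has no `2`-torsion and `2^{M₀}` kills every Kummer
class `δ_{2^{M₀+1}}(P)`, then every point of `E(F)` is twice a point (`2^{M₀} P = 2^{M₀+1} R`, cancel). [cite: SilvermanAEC2009, VIII.§2] -/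
theorem exists_eq_add_self_of_kummer_two_pow_kill (h2n : ∀ Q : A.toAffine.Point, 2 • Q = 0 → Q = 0) (M₀ : ℕ)
    (hdiv : ∀ R : geomPoints A, ∃ Q : geomPoints A, ((2 ^ (M₀ + 1) : ℕ) : ℤ) • Q = R)
    (hkill : ∀ P : A.toAffine.Point, ((2 ^ M₀ : ℕ) : ℤ) • kummerMapTorsion A ((2 ^ (M₀ + 1) : ℕ) : ℤ) hdiv P = 0)
    (P : A.toAffine.Point) : ∃ Q : A.toAffine.Point, P = Q + Q := by
  have h2t : ∀ Q : A.toAffine.Point, (2 : ℤ) • Q = 0 → Q = 0 := fun Q hQ ↦ h2n Q (by rwa [ofNat_zsmul] at hQ)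
  have hmem : ((2 ^ M₀ : ℕ) : ℤ) • P ∈ (kummerMapTorsion A ((2 ^ (M₀ + 1) : ℕ) : ℤ) hdiv).ker := by
    rw [AddMonoidHom.mem_ker, map_zsmul, hkill]
  rw [kummerMapTorsion_ker A _ hdiv] at hmem
  obtain ⟨R, hR⟩ := hmem
  have h0 : ((2 ^ M₀ : ℕ) : ℤ) • ((2 : ℤ) • R - P) = 0 := by
    rw [smul_sub, smul_smul, sub_eq_zero]
    have : ((2 ^ M₀ : ℕ) : ℤ) * 2 = ((2 ^ (M₀ + 1) : ℕ) : ℤ) := by push_cast; ring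
    rw [this]
    exact hR
  have h1 : (2 : ℤ) • R - P = 0 := eq_zero_of_two_pow_zsmul_eq_zero h2t M₀ h0
  refine ⟨R, ?_⟩
  rw [sub_eq_zero] at h1
  rw [← h1, two_zsmul]

/-- Generic-field form: if every point of `E(F)` is twice a point then `rank_ℤ E(F) = 0` (`#(E(F)/2E(F)) = 2^{rank} · #E(F)[2]`, tree
`natCard_quotient_range_zsmul`). [cite: SilvermanAEC2009, Thm. VIII.6.7] -/
theorem mordellWeilRank_eq_zero_of_forall_exists_eq_add_self (h : ∀ P : A.toAffine.Point, ∃ Q : A.toAffine.Point, P = Q + Q) :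
    A.mordellWeilRank = 0 := by
  have htop : (zsmulAddGroupHom (α := A.toAffine.Point) ((2 : ℕ) : ℤ)).range = ⊤ := by
    rw [eq_top_iff]
    intro P _
    obtain ⟨Q, hQ⟩ := h P
    exact ⟨Q, by rw [zsmulAddGroupHom_apply, hQ, Nat.cast_ofNat, two_zsmul]⟩
  have hcard := A.natCard_quotient_range_zsmul (n := 2) two_ne_zero
  rw [htop] at hcard
  have h1 : Nat.card (A.toAffine.Point ⧸ (⊤ : AddSubgroup A.toAffine.Point)) = 1 := by
    haveI : Subsingleton (A.toAffine.Point ⧸ (⊤ : AddSubgroup A.toAffine.Point)) := QuotientAddGroup.subsingleton_quotient_top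
    exact Nat.card_of_subsingleton (0 : A.toAffine.Point ⧸ (⊤ : AddSubgroup A.toAffine.Point))
  rw [h1] at hcard
  have hpow : 2 ^ A.mordellWeilRank = 1 := Nat.eq_one_of_mul_eq_one_right hcard.symm
  exact (Nat.pow_eq_one.mp hpow).resolve_left (by norm_num)

end GenericField

/-- **Every point of `E(ℚ)` is twice a point of `E(ℚ)` on U_T's habitat with `w(E) = +1`** (modulo Q2): `δ_{2^{M₀+1}}(P) ∈ Sel` is killed by
`2^{M₀}` (`two_pow_smul_selmer_rat_eq_zero_onHabitat`), so `2^{M₀} P = 2^{M₀+1} R` and `P = 2R` (`E(ℚ)` has no `2`-power torsion).  This is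
the hypothesis `hodd` of the LEAD's inflation–restriction brick `exists_resBaseChange_eq_of_conjH1Points_eq_of_rat_twoDivisible` (p748087) in
`W.toAffine.Point` currency; the `W.baseChange ℚ` currency is `exists_eq_add_self_point_baseChange_rat_onHabitat`.
[cite: Kolyvagin1989Izv, Thm. B₂] [cite: SilvermanAEC2009, VIII.§2] -/
theorem exists_eq_add_self_point_rat_onHabitat (hQ2 : KolyvaginRelationAtTwo)
    (W : WeierstrassCurve ℚ) [W.IsElliptic] [W.IsGloballyMinimal] [NeZero (W.conductorNorm ℤ)] (hcm : ¬ W.HasCM)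
    (hT : Odd W.tamagawaProduct) (v : HeightOneSpectrum (𝓞 ℚ)) (h2v : ((2 : ℕ) : 𝓞 ℚ) ∉ v.asIdeal)
    (hNv : ((W.conductorNorm ℤ : ℕ) : 𝓞 ℚ) ∈ v.asIdeal) (hmult : W.HasMultiplicativeReductionAt v) (hneg : W.Δ < 0)
    (K : Type) [Field K] [NumberField K] (hIQ : IsImaginaryQuadratic K) (hodd : Odd (NumberField.discr K))
    (h3 : NumberField.discr K ≠ -3) (hHe : SatisfiesHeegnerHypothesis (W.conductorNorm ℤ) K)
    (hsq1 : ¬ IsSquare ((NumberField.discr K : ℚ) * -|W.Δ|)) (hsq2 : ¬ IsSquare ((NumberField.discr K : ℚ) * (-(2 * |W.Δ|))))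
    (hρ : ∀ n : ℕ, 0 < n → W.HasSurjectiveModNGaloisRep ((2 : ℤ) ^ n))
    (Dt : ModularParametrizationData W (W.conductorNorm ℤ)) (β : ℤ) (ι : K →+* ℂ) (d₁ : KolyvaginHeegnerData Dt β ι 1) (M₀ : ℕ)
    (hndiv : ¬ ∃ Q : (W.baseChange (ringClassField K ι 1)).toAffine.Point, ((2 ^ (M₀ + 1) : ℕ) : ℤ) • Q = d₁.derivedPoint)
    (hw1 : W.rootNumber = 1) (P : W.toAffine.Point) : ∃ Q : W.toAffine.Point, P = Q + Q := by
  have hs2 : W.HasSurjectiveModNGaloisRep 2 := by simpa using hρ 1 one_pos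
  have hn : ((2 ^ (M₀ + 1) : ℕ) : ℤ) ≠ 0 := by positivity
  have hdiv : ∀ R : geomPoints W, ∃ Q : geomPoints W, ((2 ^ (M₀ + 1) : ℕ) : ℤ) • Q = R := W.zsmul_geomPoints_surjective_of_charZero hn
  have hkill : ∀ P : W.toAffine.Point, ((2 ^ M₀ : ℕ) : ℤ) • kummerMapTorsion W ((2 ^ (M₀ + 1) : ℕ) : ℤ) hdiv P = 0 := fun P ↦
    two_pow_smul_selmer_rat_eq_zero_onHabitat hQ2 W hcm hT v h2v hNv hmult hneg K hIQ hodd h3 hHe hsq1 hsq2 hρ Dt β ι d₁ M₀ hndiv hw1 (M₀ + 1) _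
      (WeierstrassCurve.kummerMapTorsion_mem_selmerGroup W _ hdiv P)
  obtain ⟨Q, hQ⟩ := exists_eq_add_self_of_kummer_two_pow_kill W
    (DokchitserDokchitser2012.forall_two_nsmul_of_hasSurjectiveModNGaloisRep_two W two_ne_zero hs2) M₀ hdiv hkill P
  exact ⟨Q, by convert hQ using 4⟩

/-- **The same in the `E = W.baseChange ℚ` currency** of the LEAD's brick `exists_resBaseChange_eq_of_conjH1Points_eq_of_rat_twoDivisible`
(`W.baseChange ℚ = W`, tree `baseChange_self`). [cite: Kolyvagin1989Izv, Thm. B₂] -/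
theorem exists_eq_add_self_point_baseChange_rat_onHabitat (hQ2 : KolyvaginRelationAtTwo)
    (W : WeierstrassCurve ℚ) [W.IsElliptic] [W.IsGloballyMinimal] [NeZero (W.conductorNorm ℤ)] (hcm : ¬ W.HasCM)
    (hT : Odd W.tamagawaProduct) (v : HeightOneSpectrum (𝓞 ℚ)) (h2v : ((2 : ℕ) : 𝓞 ℚ) ∉ v.asIdeal)
    (hNv : ((W.conductorNorm ℤ : ℕ) : 𝓞 ℚ) ∈ v.asIdeal) (hmult : W.HasMultiplicativeReductionAt v) (hneg : W.Δ < 0)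
    (K : Type) [Field K] [NumberField K] (hIQ : IsImaginaryQuadratic K) (hodd : Odd (NumberField.discr K))
    (h3 : NumberField.discr K ≠ -3) (hHe : SatisfiesHeegnerHypothesis (W.conductorNorm ℤ) K)
    (hsq1 : ¬ IsSquare ((NumberField.discr K : ℚ) * -|W.Δ|)) (hsq2 : ¬ IsSquare ((NumberField.discr K : ℚ) * (-(2 * |W.Δ|))))
    (hρ : ∀ n : ℕ, 0 < n → W.HasSurjectiveModNGaloisRep ((2 : ℤ) ^ n))
    (Dt : ModularParametrizationData W (W.conductorNorm ℤ)) (β : ℤ) (ι : K →+* ℂ) (d₁ : KolyvaginHeegnerData Dt β ι 1) (M₀ : ℕ)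
    (hndiv : ¬ ∃ Q : (W.baseChange (ringClassField K ι 1)).toAffine.Point, ((2 ^ (M₀ + 1) : ℕ) : ℤ) • Q = d₁.derivedPoint)
    (hw1 : W.rootNumber = 1) : ∀ P : (W.baseChange ℚ).toAffine.Point, ∃ Q : (W.baseChange ℚ).toAffine.Point, P = Q + Q := by
  rw [Literature.NumberTheory.EllipticCurves.baseChange_self]
  intro P
  obtain ⟨Q, hQ⟩ := exists_eq_add_self_point_rat_onHabitat hQ2 W hcm hT v h2v hNv hmult hneg K hIQ hodd h3 hHe hsq1 hsq2 hρ Dt β ι d₁ M₀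
    hndiv hw1 P
  exact ⟨Q, by convert hQ using 4⟩

/-- **`rank_ℤ E(ℚ) = 0` on U_T's habitat with `w(E) = +1`** (Kolyvagin's theorem over `ℚ`, AT `2`, from the Heegner index and Q2 — no
L-value input): `E(ℚ) = 2E(ℚ)` and `#(E(ℚ)/2E(ℚ)) = 2^{rank} · #E(ℚ)[2]` (tree `natCard_quotient_range_zsmul`).
[cite: Kolyvagin1989Izv, Thm. B₂] [cite: GrossLMS1991, §1 Thm. 1.3] [cite: SilvermanAEC2009, Thm. VIII.6.7] -/
theorem mordellWeilRank_rat_eq_zero_onHabitat (hQ2 : KolyvaginRelationAtTwo)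
    (W : WeierstrassCurve ℚ) [W.IsElliptic] [W.IsGloballyMinimal] [NeZero (W.conductorNorm ℤ)] (hcm : ¬ W.HasCM)
    (hT : Odd W.tamagawaProduct) (v : HeightOneSpectrum (𝓞 ℚ)) (h2v : ((2 : ℕ) : 𝓞 ℚ) ∉ v.asIdeal)
    (hNv : ((W.conductorNorm ℤ : ℕ) : 𝓞 ℚ) ∈ v.asIdeal) (hmult : W.HasMultiplicativeReductionAt v) (hneg : W.Δ < 0)
    (K : Type) [Field K] [NumberField K] (hIQ : IsImaginaryQuadratic K) (hodd : Odd (NumberField.discr K))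
    (h3 : NumberField.discr K ≠ -3) (hHe : SatisfiesHeegnerHypothesis (W.conductorNorm ℤ) K)
    (hsq1 : ¬ IsSquare ((NumberField.discr K : ℚ) * -|W.Δ|)) (hsq2 : ¬ IsSquare ((NumberField.discr K : ℚ) * (-(2 * |W.Δ|))))
    (hρ : ∀ n : ℕ, 0 < n → W.HasSurjectiveModNGaloisRep ((2 : ℤ) ^ n))
    (Dt : ModularParametrizationData W (W.conductorNorm ℤ)) (β : ℤ) (ι : K →+* ℂ) (d₁ : KolyvaginHeegnerData Dt β ι 1) (M₀ : ℕ)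
    (hndiv : ¬ ∃ Q : (W.baseChange (ringClassField K ι 1)).toAffine.Point, ((2 ^ (M₀ + 1) : ℕ) : ℤ) • Q = d₁.derivedPoint)
    (hw1 : W.rootNumber = 1) : W.mordellWeilRank = 0 := by
  have hs2 : W.HasSurjectiveModNGaloisRep 2 := by simpa using hρ 1 one_pos
  have hn : ((2 ^ (M₀ + 1) : ℕ) : ℤ) ≠ 0 := by positivity
  have hdiv : ∀ R : geomPoints W, ∃ Q : geomPoints W, ((2 ^ (M₀ + 1) : ℕ) : ℤ) • Q = R := W.zsmul_geomPoints_surjective_of_charZero hn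
  have hkill : ∀ P : W.toAffine.Point, ((2 ^ M₀ : ℕ) : ℤ) • kummerMapTorsion W ((2 ^ (M₀ + 1) : ℕ) : ℤ) hdiv P = 0 := fun P ↦
    two_pow_smul_selmer_rat_eq_zero_onHabitat hQ2 W hcm hT v h2v hNv hmult hneg K hIQ hodd h3 hHe hsq1 hsq2 hρ Dt β ι d₁ M₀ hndiv hw1 (M₀ + 1) _
      (WeierstrassCurve.kummerMapTorsion_mem_selmerGroup W _ hdiv P)
  exact mordellWeilRank_eq_zero_of_forall_exists_eq_add_self W fun P ↦ exists_eq_add_self_of_kummer_two_pow_kill W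
    (DokchitserDokchitser2012.forall_two_nsmul_of_hasSurjectiveModNGaloisRep_two W two_ne_zero hs2) M₀ hdiv hkill P

end Summit.BirchSwinnertonDyer.BirchSwinnertonDyer.Theorems.GenusExact.PlusDescent

end
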